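import Summits.BirchSwinnertonDyer.BirchSwinnertonDyer.Theorems.PrintCf2SplitBadTwoCMPrimaryLocalFixedPoints
import Summits.BirchSwinnertonDyer.BirchSwinnertonDyer.Theorems.PrintCf2SplitBadTwoRestrictedSelmerEigenProjector
import Summits.BirchSwinnertonDyer.BirchSwinnertonDyer.Theorems.PrintCf2SplitBadTwoInertiaFixedTorsionSharp
import Summits.BirchSwinnertonDyer.BirchSwinnertonDyer.Theorems.PrintCf2SplitBadTwoAdditiveAtSeven
import Summits.BirchSwinnertonDyer.Rank1Residual.X11b.LocalTrivialityBridge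
import HarnessLib

/-!
# Crux `PrintCf2.SplitBadTwoRankOneOfFacts` (stmt-BirchSwinnertonDyer-20368), road α v10.3 — the LOCAL TORSION BOUND `hfix`:
# `E[2^∞]^{Γ_{K_v}} ⊆ E[4]` on every S3c frame

Cell `bsd-print-cf2`, width seat `bsd-line-cf2-p1-w2` g10 (prover-bsd-line-cf2-p1-w2-g10-0); `--supports
stmt-BirchSwinnertonDyer-20368` (helper, Theses-free). HONEST FRAMING: nothing here closes a crux or a stub; BSD is not
proved by any of this; no summit statement is proved by this seat. THEOREMS ONLY (no definition, no named fact, no `sorry`).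

WHAT. The hypothesis **`hfix`** of -w4 g9's assembled (R-TOP) `RestrictedSelmerPair.natCard_endCoinvariants_eq_one_of_frame_of_conjFiniteness`
(p673077; the local torsion bound feeding the (LS) level-lifting `locSurj_of_proj`): on a frame `(K, v, v̄, π, r)`,
`∃ m, ∀ Q ∈ E[2^∞], (∀ σ ∈ Γ_{K_v}, σ·Q = Q) → 2^m·Q = 0` (the action through `absGaloisRestrict K K_v`, x11b's
`primaryGaloisModule`). PROVED with `m = 2` (`exists_two_pow_nsmul_eq_zero_of_fixed_of_frame`, and the `j = −3375` form
`four_nsmul_eq_zero_of_fixed_decomp`): `E[2^∞] = E[𝔮_r^∞] ⊕ E[𝔮_{1−r}^∞]` through -w7's equivariant projector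
(`exists_eigenProjector_two`), and on EACH summand -w2 g8's `CMPrimes.exists_mem_decomp_four_nsmul_eq_zero_of_smul_eq` supplies an
element of the decomposition group `D_v` all of whose fixed points lie in the `4`-torsion (a Frobenius acting as `±α`, `α − 1 ∉ 4ℤ₂`,
in the unramified-twist summand; an inertia element acting as `±3` in the kernel-of-reduction summand). So `E[2^∞]^{D_v} ⊆ E[4]`:
the «generic Mattuck-type lemma» is not needed on this class.

References: K. Rubin, LNM 1716 (1999) §3 Lemma 3.6 (ii), Cor. 3.17 [Rubin1999]; J. Neukirch, *Algebraic Number Theory* II (7.13),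
II §9 (9.6) [NeukirchANT1999]; A. Agboola, Compositio 143 (2007) §5 Prop. 5.1 [Agboola2007].
-/

noncomputable section

open scoped Classical

set_option linter.dupNamespace false
set_option autoImplicit false

namespace Summit.BirchSwinnertonDyer.BirchSwinnertonDyer.Theorems.PrintCf2.CMPrimes

open WeierstrassCurve Literature.NumberTheory.EllipticCurves Literature.NumberTheory.EllipticCurves.GreenbergSelmer
open Literature.NumberTheory.GaloisRepresentations Field NumberField IsDedekindDomain
open Summit.BirchSwinnertonDyer.BirchSwinnertonDyer.Theorems.PrintCf2.RestrictedSelmerPair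
open Summit.BirchSwinnertonDyer.BirchSwinnertonDyer.Theorems.PrintCf2.AdditiveAtSeven
open Summit.BirchSwinnertonDyer.Rank1Residual.X11b.LocBridge

variable (W : WeierstrassCurve ℚ) [W.IsElliptic] (K : Type) [Field K] [NumberField K]

/-- **`E[2^∞]^{D_v} ⊆ E[4]`** (`j = −3375`, `[K:ℚ] = 2` with `√−7 ∈ K`, `2 = v·v̄`, `π² = π − 2`, `r² = r − 2`): a point of `E[2^∞]`
fixed by the whole decomposition group `GreenbergSelmer.decomp v` is killed by `4`. Split `Q = eQ + (Q − eQ)` along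
`E[2^∞] = E[𝔮_r^∞] ⊕ E[𝔮_{1−r}^∞]` (-w7's equivariant projector); each piece is `D_v`-fixed and lies in a summand, where some
`δ ∈ D_v` has all its fixed points in the `4`-torsion (-w2 g8 `exists_mem_decomp_four_nsmul_eq_zero_of_smul_eq`, either root).
[cite: Rubin1999, §3 Lemma 3.6 (ii) and Cor. 3.17] [cite: NeukirchANT1999, Ch. II (7.13)] -/
theorem four_nsmul_eq_zero_of_fixed_decomp (hj : W.j = -3375) (hK2 : Module.finrank ℚ K = 2) {θ : K} (hθ : θ ^ 2 = -7)
    (π : (W.baseChange K).endRing) (hrel : (π : AddMonoid.End (W.baseChange K).geomPoints) * π = π - 2)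
    {r : ℤ_[2]} (hr : r * r = r - 2) {v vbar : HeightOneSpectrum (𝓞 K)}
    (hv : ((2 : ℕ) : 𝓞 K) ∈ v.asIdeal) (hvbar : ((2 : ℕ) : 𝓞 K) ∈ vbar.asIdeal) (hne : vbar ≠ v)
    (Q : (W.baseChange K).geomPrimaryTorsion 2) (hQ : ∀ δ ∈ GreenbergSelmer.decomp v, δ • Q = Q) : 4 • Q = 0 := by
  haveI : Fact (Nat.Prime 2) := ⟨Nat.prime_two⟩
  have hr' : (1 - r) * (1 - r) = (1 - r) - 2 := by linear_combination hr
  obtain ⟨e, -, -, hesub, he⟩ := exists_eigenProjector_two W hj K hθ π hrel hr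
  obtain ⟨δ₁, hδ₁, h₁⟩ := exists_mem_decomp_four_nsmul_eq_zero_of_smul_eq W K hj hK2 hθ π hrel hr hv hvbar hne
  obtain ⟨δ₂, hδ₂, h₂⟩ := exists_mem_decomp_four_nsmul_eq_zero_of_smul_eq W K hj hK2 hθ π hrel hr' hv hvbar hne
  -- the `E[𝔮_r^∞]`-component
  have hfix₁ : δ₁ • ((e Q : ↥((W.baseChange K).endEigenPrimaryTorsion 2 π r)) : (W.baseChange K).geomPrimaryTorsion 2) =
      (e Q : (W.baseChange K).geomPrimaryTorsion 2) := by
    rw [← WeierstrassCurve.endEigenPrimaryTorsion.coe_smul, ← he, hQ δ₁ hδ₁]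
  have h4₁ : 4 • ((e Q : ↥((W.baseChange K).endEigenPrimaryTorsion 2 π r)) : (W.baseChange K).geomPrimaryTorsion 2) = 0 :=
    h₁ _ (e Q).2 hfix₁
  -- the `E[𝔮_{1−r}^∞]`-component
  have hfix₂ : δ₂ • (Q - (e Q : (W.baseChange K).geomPrimaryTorsion 2)) = Q - (e Q : (W.baseChange K).geomPrimaryTorsion 2) := by
    rw [smul_sub, hQ δ₂ hδ₂, ← WeierstrassCurve.endEigenPrimaryTorsion.coe_smul, ← he, hQ δ₂ hδ₂]
  have h4₂ : 4 • (Q - (e Q : (W.baseChange K).geomPrimaryTorsion 2)) = 0 := h₂ _ (hesub Q) hfix₂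
  have : Q = (e Q : (W.baseChange K).geomPrimaryTorsion 2) + (Q - (e Q : (W.baseChange K).geomPrimaryTorsion 2)) := by abel
  rw [this, smul_add, h4₁, h4₂, add_zero]

/-- The same with the fixedness hypothesis in the LOCAL-GALOIS-GROUP currency of x11b's `primaryGaloisModule` (the action of
`σ ∈ Γ_{K_v}` through `absGaloisRestrict K K_v`, `GaloisRep.restrictField`): `D_v` is by definition the image of `Γ_{K_v}`.
[cite: NeukirchANT1999, Ch. II §9 Prop. (9.6)] -/
theorem four_nsmul_eq_zero_of_fixed_adicCompletion (hj : W.j = -3375) (hK2 : Module.finrank ℚ K = 2) {θ : K} (hθ : θ ^ 2 = -7)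
    (π : (W.baseChange K).endRing) (hrel : (π : AddMonoid.End (W.baseChange K).geomPoints) * π = π - 2)
    {r : ℤ_[2]} (hr : r * r = r - 2) {v vbar : HeightOneSpectrum (𝓞 K)}
    (hv : ((2 : ℕ) : 𝓞 K) ∈ v.asIdeal) (hvbar : ((2 : ℕ) : 𝓞 K) ∈ vbar.asIdeal) (hne : vbar ≠ v)
    (Q : (W.baseChange K).geomPrimaryTorsion 2)
    (hQ : ∀ σ : absoluteGaloisGroup (v.adicCompletion K),
      GaloisRep.restrictField (v.adicCompletion K) (primaryGaloisModule (W.baseChange K) 2) σ Q = Q) : 4 • Q = 0 := by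
  refine four_nsmul_eq_zero_of_fixed_decomp W K hj hK2 hθ π hrel hr hv hvbar hne Q fun δ hδ ↦ ?_
  obtain ⟨σ, rfl⟩ := (GreenbergSelmer.mem_decomp_iff v δ).1 hδ
  exact hQ σ

/-- **`hfix` ON EVERY S3c FRAME** — the local torsion bound of -w4 g9's `natCard_endCoinvariants_eq_one_of_frame_of_conjFiniteness`
(p673077) / `locSurj_of_proj`, with `m = 2`: for a member `C • W = cm7^{(d)}`, `K` imaginary quadratic with `2 = v·v̄`, `π² = π − 2`,
`r² = r − 2`: `∃ m, ∀ Q ∈ E[2^∞], (∀ σ ∈ Γ_{K_v}, σ·Q = Q) → 2^m·Q = 0`. (`j = −3375` by `j_eq_of_smul_eq_cm7Twist`; `√−7 ∈ K` by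
`exists_sq_eq_neg_seven_of_cmEndo_mem_endRing`.) [cite: Rubin1999, §3 Lemma 3.6 (ii) and Cor. 3.17] [cite: Agboola2007, §5 Prop. 5.1] -/
theorem exists_two_pow_nsmul_eq_zero_of_fixed_of_frame {d : ℤ} (hd0 : d ≠ 0) (C : VariableChange ℚ)
    (hC : C • W = cm7.quadraticTwist (d : ℚ)) (hK : IsImaginaryQuadratic K) (v vbar : HeightOneSpectrum (𝓞 K))
    (hv : ((2 : ℕ) : 𝓞 K) ∈ v.asIdeal) (hvbar : ((2 : ℕ) : 𝓞 K) ∈ vbar.asIdeal) (hne : vbar ≠ v)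
    (π : (W.baseChange K).endRing) (hrel : (π : AddMonoid.End (W.baseChange K).geomPoints) * π = π - 2)
    {r : ℤ_[2]} (hr : r * r = r - 2) :
    ∃ m : ℕ, ∀ Q : (W.baseChange K).geomPrimaryTorsion 2,
      (∀ σ : absoluteGaloisGroup (v.adicCompletion K),
        GaloisRep.restrictField (v.adicCompletion K) (primaryGaloisModule (W.baseChange K) 2) σ Q = Q) → 2 ^ m • Q = 0 := by
  have hj : W.j = -3375 := j_eq_of_smul_eq_cm7Twist hd0 W C hC
  obtain ⟨θ, hθ⟩ := exists_sq_eq_neg_seven_of_cmEndo_mem_endRing W K hj π hrel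
  refine ⟨2, fun Q hQ ↦ ?_⟩
  rw [show (2 : ℕ) ^ 2 = 4 by norm_num]
  exact four_nsmul_eq_zero_of_fixed_adicCompletion W K hj hK.1 hθ π hrel hr hv hvbar hne Q hQ

/-- The same bound at the OTHER place `v̄` (swap the roles of `v` and `v̄`). [cite: Rubin1999, §3 Lemma 3.6 (ii) and Cor. 3.17] -/
theorem exists_two_pow_nsmul_eq_zero_of_fixed_of_frame_bar {d : ℤ} (hd0 : d ≠ 0) (C : VariableChange ℚ)
    (hC : C • W = cm7.quadraticTwist (d : ℚ)) (hK : IsImaginaryQuadratic K) (v vbar : HeightOneSpectrum (𝓞 K))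
    (hv : ((2 : ℕ) : 𝓞 K) ∈ v.asIdeal) (hvbar : ((2 : ℕ) : 𝓞 K) ∈ vbar.asIdeal) (hne : vbar ≠ v)
    (π : (W.baseChange K).endRing) (hrel : (π : AddMonoid.End (W.baseChange K).geomPoints) * π = π - 2)
    {r : ℤ_[2]} (hr : r * r = r - 2) :
    ∃ m : ℕ, ∀ Q : (W.baseChange K).geomPrimaryTorsion 2,
      (∀ σ : absoluteGaloisGroup (vbar.adicCompletion K),
        GaloisRep.restrictField (vbar.adicCompletion K) (primaryGaloisModule (W.baseChange K) 2) σ Q = Q) → 2 ^ m • Q = 0 :=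
  exists_two_pow_nsmul_eq_zero_of_fixed_of_frame W K hd0 C hC hK vbar v hvbar hv hne.symm π hrel hr

end Summit.BirchSwinnertonDyer.BirchSwinnertonDyer.Theorems.PrintCf2.CMPrimes

end
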